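import Summits.Ventures.Crystal3D.Theorems.StickyWulffConstantNoReconstructionGainExactHalfBallCore
import Summits.Ventures.Crystal3D.Theorems.StickyWulffConstantNoReconstructionGainLayerCover
import Summits.Ventures.Crystal3D.Theorems.StickyWulffConstantNoReconstructionGainSymmetry
import HarnessLib

/-!
# Film balls lie strictly ABOVE the cut, II: basal cone of normals (line `replication-exactness`)

HONEST FRAMING. Part of the venture `Summits/Ventures/Crystal3D` (cell `crystal3d-full`), supports the
crux `NoReconstructionGain` (stmt-Ventures-19144, route `route-Ventures-StickyWulffConstant`), line
`replication-exactness` (lead wulff-p1 g18).  A basic geometric fact about films on the rigid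
half-crystal `H(ν,s) = Λ₀ ∩ {⟪p,ν⟫ ≤ s}` (`Λ₀ = fccStacking 1 √(2/3)`), so far available only in the
weak form `s − 3/4 < ⟪q,ν⟫` (`film_height_gt`):

* (part I, `…ExactHalfBallCore`: the planar core `planar_halfBall_core` over one sector of a layer;)
* `exists_fcc_below_near_of_cone` — **the lower open unit half-ball of every point contains a lattice
  site**, for every unit normal `ν` in the basal double cone `ν₃² ≥ 1/3` (within `54.7°` of the
  stacking axis of the tree frame): `∃ p ∈ Λ₀, ⟪p,ν⟫ ≤ ⟪x,ν⟫ ∧ dist x p < 1` (the layer at or below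
  `x`, its covering site `exists_fccSite_planar_sq_le_third`, the sector of the planar offset, the
  core; the lower nappe by the point symmetry `fcc_neg_mem`);
* `IsFilmOn.lt_inner_of_cone` — hence **every ball of a film on `H(ν,s)` with `ν₃² ≥ 1/3` lies
  strictly above the cut, `s < ⟪q,ν⟫`**, and (`plug_below_of_cone`) every plug of a film ball is
  strictly `ν`-below it.  So on these faces the `ν`-height orientation has no "overhang plugs":
  `slack = Σ_q (6 − #lower partners − #plugs)` exactly, and the hypotheses `s ≤ ⟪q,ν⟫` of
  `exists_cup_window_of_criminal` / `exists_buried_offLattice_of_criminal` are automatic.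

WHAT THIS IS NOT: the remaining normals (`ν₃² < 1/3`) need the same statement for the other three
`{111}` families via the lattice isometries of `…CubicActions` (not done here); nothing about the crux
itself; rung F-C1 not moved.
-/

noncomputable section

namespace Summit.Ventures.Crystal3D.Theorems

open Summit.Ventures.Crystal3D
open Literature.MathematicalPhysics.StatisticalMechanics (fccStacking barlowPos constHagg haggLabel_const
  barlowPos_apply_zero barlowPos_apply_one barlowPos_apply_two mem_barlowStacking_iff)
open scoped InnerProductSpace
open Finset

/-! ## The lower half-ball of every point contains a lattice site (basal cone) -/

/-- **Upper nappe.**  For every unit `ν` with `ν₃² ≥ 1/3`, `ν₃ ≥ 0` and every point `x` there is a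
site `p` of `Λ₀ = fccStacking 1 √(2/3)` with `⟪p, ν⟫ ≤ ⟪x, ν⟫` and `dist x p < 1`. -/
theorem exists_fcc_below_near_of_cone_pos {ν : EuclideanSpace ℝ (Fin 3)} (hν : ‖ν‖ = 1)
    (hν3 : 1 / 3 ≤ ν 2 ^ 2) (hν3' : 0 ≤ ν 2) (x : EuclideanSpace ℝ (Fin 3)) :
    ∃ p ∈ fccStacking 1 (Real.sqrt (2 / 3)), ⟪p, ν⟫_ℝ ≤ ⟪x, ν⟫_ℝ ∧ dist x p < 1 := by
  -- the layer at or below `x`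
  set h : ℝ := Real.sqrt (2 / 3) with hh
  have hhpos : 0 < h := Real.sqrt_pos.2 (by norm_num)
  have hh2 : h ^ 2 = 2 / 3 := Real.sq_sqrt (by norm_num)
  set k : ℤ := ⌊x 2 / h⌋ with hk
  set Δ : ℝ := x 2 - k * h with hΔ
  have hΔ0 : 0 ≤ Δ := by
    have := Int.floor_le (x 2 / h)
    rw [hΔ]
    have : (k : ℝ) * h ≤ x 2 := by
      calc (k : ℝ) * h ≤ x 2 / h * h := mul_le_mul_of_nonneg_right this hhpos.le
        _ = x 2 := div_mul_cancel₀ _ hhpos.ne'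
    linarith
  have hΔh : Δ < h := by
    have := Int.lt_floor_add_one (x 2 / h)
    rw [hΔ]
    have : x 2 < ((k : ℝ) + 1) * h := by
      calc x 2 = x 2 / h * h := (div_mul_cancel₀ _ hhpos.ne').symm
        _ < ((k : ℝ) + 1) * h := mul_lt_mul_of_pos_right this hhpos
    linarith
  have hΔ2 : Δ ^ 2 < 2 / 3 := by
    rw [← hh2, pow_two, pow_two]; exact mul_self_lt_mul_self hΔ0 hΔh
  -- the covering site of that layer
  obtain ⟨i, j, hij⟩ := exists_fccSite_planar_sq_le_third (x 0) (x 1) k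
  have h3 : Real.sqrt 3 ^ 2 = 3 := Real.sq_sqrt (by norm_num)
  -- coordinates of sites of layer `k`
  have hP0 : ∀ i' j' : ℤ, barlowPos 1 (Real.sqrt (2 / 3)) constHagg k i' j' 0 =
      (i' : ℝ) + (j' : ℝ) / 2 + (k : ℝ) / 2 := by
    intro i' j'; rw [barlowPos_apply_zero, haggLabel_const]; ring
  have hP1 : ∀ i' j' : ℤ, barlowPos 1 (Real.sqrt (2 / 3)) constHagg k i' j' 1 =
      Real.sqrt 3 / 2 * ((j' : ℝ) + (k : ℝ) / 3) := by
    intro i' j'; rw [barlowPos_apply_one, haggLabel_const]; ring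
  have hP2 : ∀ i' j' : ℤ, barlowPos 1 (Real.sqrt (2 / 3)) constHagg k i' j' 2 = (k : ℝ) * h := by
    intro i' j'; rw [barlowPos_apply_two]
  -- planar offset of `x` from the covering site
  set y0 : ℝ := x 0 - barlowPos 1 (Real.sqrt (2 / 3)) constHagg k i j 0 with hy0
  set y1 : ℝ := x 1 - barlowPos 1 (Real.sqrt (2 / 3)) constHagg k i j 1 with hy1
  have hyy : y0 ^ 2 + y1 ^ 2 ≤ 1 / 3 := hij
  -- the unit normal in coordinates
  have hn : ν 0 ^ 2 + ν 1 ^ 2 + ν 2 ^ 2 = 1 := by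
    have h1 : ‖ν‖ ^ 2 = 1 := by rw [hν]; norm_num
    rw [EuclideanSpace.real_norm_sq_eq, Fin.sum_univ_three] at h1
    linarith
  have hinner : ∀ a b : EuclideanSpace ℝ (Fin 3), ⟪a, b⟫_ℝ = a 0 * b 0 + a 1 * b 1 + a 2 * b 2 := by
    intro a b; simp [PiLp.inner_apply, Fin.sum_univ_three, mul_comm]
  -- how a site `(k, i+di, j+dj)` with planar offset `(c0, c1)` from the covering site settles the claim
  have finish : ∀ (di dj : ℤ) (c0 c1 : ℝ),
      (c0 = (di : ℝ) + (dj : ℝ) / 2) → (c1 = Real.sqrt 3 / 2 * (dj : ℝ)) →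
      (c0 - y0) ^ 2 + (c1 - y1) ^ 2 + Δ ^ 2 < 1 → (c0 - y0) * ν 0 + (c1 - y1) * ν 1 ≤ Δ * ν 2 →
      ∃ p ∈ fccStacking 1 (Real.sqrt (2 / 3)), ⟪p, ν⟫_ℝ ≤ ⟪x, ν⟫_ℝ ∧ dist x p < 1 := by
    intro di dj c0 c1 hc0 hc1 hdist hheight
    set p := barlowPos 1 (Real.sqrt (2 / 3)) constHagg k (i + di) (j + dj) with hp
    have hp0 : p 0 - x 0 = c0 - y0 := by
      rw [hp, hP0, hy0, hP0, hc0]; push_cast; ring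
    have hp1 : p 1 - x 1 = c1 - y1 := by
      rw [hp, hP1, hy1, hP1, hc1]; push_cast; ring
    have hp2 : p 2 - x 2 = -Δ := by rw [hp, hP2, hΔ]; ring
    refine ⟨p, mem_barlowStacking_iff.2 ⟨k, i + di, j + dj, rfl⟩, ?_, ?_⟩
    · have hsub : ⟪p, ν⟫_ℝ - ⟪x, ν⟫_ℝ = (p 0 - x 0) * ν 0 + (p 1 - x 1) * ν 1 + (p 2 - x 2) * ν 2 := by
        rw [hinner, hinner]; ring
      rw [hp0, hp1, hp2] at hsub
      linarith
    · rw [EuclideanSpace.dist_eq, Real.sqrt_lt' one_pos, Fin.sum_univ_three]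
      simp only [Real.dist_eq, sq_abs, one_pow]
      have e0 : (x 0 - p 0) ^ 2 = (c0 - y0) ^ 2 := by rw [← hp0]; ring
      have e1 : (x 1 - p 1) ^ 2 = (c1 - y1) ^ 2 := by rw [← hp1]; ring
      have e2' : x 2 - p 2 = Δ := by linarith
      rw [e0, e1, e2']; exact hdist
  -- the six sectors; in each, the planar core with the two bounding lattice directions
  have hs3 : 0 < Real.sqrt 3 := Real.sqrt_pos.2 (by norm_num)
  -- unit / angle facts for the directions `d₁ = (1,0)`, `d₂ = (1/2, √3/2)`, `d₃ = (−1/2, √3/2)`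
  have u1 : (1 : ℝ) ^ 2 + (0 : ℝ) ^ 2 = 1 := by norm_num
  have u2 : (1 / 2 : ℝ) ^ 2 + (Real.sqrt 3 / 2) ^ 2 = 1 := by linear_combination (1 / 4) * h3
  have u3 : (-(1 / 2) : ℝ) ^ 2 + (Real.sqrt 3 / 2) ^ 2 = 1 := by linear_combination (1 / 4) * h3
  have u4 : (-1 : ℝ) ^ 2 + (0 : ℝ) ^ 2 = 1 := by norm_num
  have u5 : (-(1 / 2) : ℝ) ^ 2 + (-(Real.sqrt 3 / 2)) ^ 2 = 1 := by linear_combination (1 / 4) * h3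
  have u6 : (1 / 2 : ℝ) ^ 2 + (-(Real.sqrt 3 / 2)) ^ 2 = 1 := by linear_combination (1 / 4) * h3
  have a12 : (1 : ℝ) * (1 / 2) + 0 * (Real.sqrt 3 / 2) = 1 / 2 := by ring
  have a23 : (1 / 2 : ℝ) * (-(1 / 2)) + Real.sqrt 3 / 2 * (Real.sqrt 3 / 2) = 1 / 2 := by
    linear_combination (1 / 4) * h3
  have a34 : (-(1 / 2) : ℝ) * (-1) + Real.sqrt 3 / 2 * 0 = 1 / 2 := by ring
  have a45 : (-1 : ℝ) * (-(1 / 2)) + 0 * (-(Real.sqrt 3 / 2)) = 1 / 2 := by ring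
  have a56 : (-(1 / 2) : ℝ) * (1 / 2) + (-(Real.sqrt 3 / 2)) * (-(Real.sqrt 3 / 2)) = 1 / 2 := by
    linear_combination (1 / 4) * h3
  have a61 : (1 / 2 : ℝ) * 1 + (-(Real.sqrt 3 / 2)) * 0 = 1 / 2 := by ring
  -- lattice coordinates of `y`: `y = σ d₁ + τ d₂` with `τ = 2 y1/√3`, `σ = y0 − y1/√3`
  set τ : ℝ := 2 * y1 / Real.sqrt 3 with hτ
  set σ : ℝ := y0 - y1 / Real.sqrt 3 with hσ
  have hyτ : y1 = Real.sqrt 3 / 2 * τ := by rw [hτ]; field_simp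
  have hyσ : y0 = σ + τ / 2 := by rw [hσ, hτ]; ring
  have hnorm : y0 ^ 2 + y1 ^ 2 = σ ^ 2 + τ ^ 2 + σ * τ := by
    rw [hyσ, hyτ]; linear_combination (τ ^ 2 / 4) * h3
  -- sector 1: σ ≥ 0, τ ≥ 0  (d₁, d₂)
  by_cases hτ0 : 0 ≤ τ
  · by_cases hσ0 : 0 ≤ σ
    · have hg : σ ^ 2 + τ ^ 2 + σ * τ ≤ 1 / 3 := by
        linarith [hnorm]
      obtain ⟨c0, c1, hc, hd, hhgt⟩ := planar_halfBall_core (y0 := y0) (y1 := y1)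
        (n0 := ν 0) (n1 := ν 1) (n3 := ν 2) (Δ := Δ) u1 u2 a12 hσ0 hτ0 hg
        (by rw [hyσ]; ring) (by rw [hyτ]; ring) hn hν3 hν3' hΔ0 hΔ2
      rcases hc with ⟨rfl, rfl⟩ | ⟨rfl, rfl⟩ | ⟨rfl, rfl⟩
      · exact finish 0 0 0 0 (by push_cast; ring) (by push_cast; ring) hd hhgt
      · exact finish 1 0 1 0 (by push_cast; ring) (by push_cast; ring) hd hhgt
      · exact finish 0 1 (1 / 2) (Real.sqrt 3 / 2) (by push_cast; ring) (by push_cast; ring) hd hhgt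
    · push Not at hσ0
      -- τ ≥ 0, σ < 0: either sector (d₂, d₃) [σ + τ ≥ 0] or sector (d₃, d₄) [σ + τ < 0]
      by_cases hστ : 0 ≤ σ + τ
      · -- y = (σ+τ) d₂ + (−σ) d₃
        have hg : (σ + τ) ^ 2 + (-σ) ^ 2 + (σ + τ) * (-σ) ≤ 1 / 3 := by
          have : y0 ^ 2 + y1 ^ 2 = (σ + τ) ^ 2 + (-σ) ^ 2 + (σ + τ) * (-σ) := by rw [hnorm]; ring
          linarith
        obtain ⟨c0, c1, hc, hd, hhgt⟩ := planar_halfBall_core (y0 := y0) (y1 := y1)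
          (n0 := ν 0) (n1 := ν 1) (n3 := ν 2) (Δ := Δ) u2 u3 a23 hστ (by linarith) hg
          (by rw [hyσ]; ring) (by rw [hyτ]; ring) hn hν3 hν3' hΔ0 hΔ2
        rcases hc with ⟨rfl, rfl⟩ | ⟨rfl, rfl⟩ | ⟨rfl, rfl⟩
        · exact finish 0 0 0 0 (by push_cast; ring) (by push_cast; ring) hd hhgt
        · exact finish 0 1 (1 / 2) (Real.sqrt 3 / 2) (by push_cast; ring) (by push_cast; ring) hd hhgt
        · exact finish (-1) 1 (-(1 / 2)) (Real.sqrt 3 / 2) (by push_cast; ring) (by push_cast; ring)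
            hd hhgt
      · push Not at hστ
        -- y = τ d₃ + (−σ−τ) d₄
        have hg : τ ^ 2 + (-σ - τ) ^ 2 + τ * (-σ - τ) ≤ 1 / 3 := by
          have : y0 ^ 2 + y1 ^ 2 = τ ^ 2 + (-σ - τ) ^ 2 + τ * (-σ - τ) := by rw [hnorm]; ring
          linarith
        obtain ⟨c0, c1, hc, hd, hhgt⟩ := planar_halfBall_core (y0 := y0) (y1 := y1)
          (n0 := ν 0) (n1 := ν 1) (n3 := ν 2) (Δ := Δ) u3 u4 a34 hτ0 (by linarith) hg
          (by rw [hyσ]; ring) (by rw [hyτ]; ring) hn hν3 hν3' hΔ0 hΔ2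
        rcases hc with ⟨rfl, rfl⟩ | ⟨rfl, rfl⟩ | ⟨rfl, rfl⟩
        · exact finish 0 0 0 0 (by push_cast; ring) (by push_cast; ring) hd hhgt
        · exact finish (-1) 1 (-(1 / 2)) (Real.sqrt 3 / 2) (by push_cast; ring) (by push_cast; ring)
            hd hhgt
        · exact finish (-1) 0 (-1) 0 (by push_cast; ring) (by push_cast; ring) hd hhgt
  · push Not at hτ0
    by_cases hσ0 : σ ≤ 0
    · -- y = (−σ) d₄ + (−τ) d₅
      have hg : (-σ) ^ 2 + (-τ) ^ 2 + (-σ) * (-τ) ≤ 1 / 3 := by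
        have : y0 ^ 2 + y1 ^ 2 = (-σ) ^ 2 + (-τ) ^ 2 + (-σ) * (-τ) := by rw [hnorm]; ring
        linarith
      obtain ⟨c0, c1, hc, hd, hhgt⟩ := planar_halfBall_core (y0 := y0) (y1 := y1)
        (n0 := ν 0) (n1 := ν 1) (n3 := ν 2) (Δ := Δ) u4 u5 a45 (by linarith) (by linarith) hg
        (by rw [hyσ]; ring) (by rw [hyτ]; ring) hn hν3 hν3' hΔ0 hΔ2
      rcases hc with ⟨rfl, rfl⟩ | ⟨rfl, rfl⟩ | ⟨rfl, rfl⟩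
      · exact finish 0 0 0 0 (by push_cast; ring) (by push_cast; ring) hd hhgt
      · exact finish (-1) 0 (-1) 0 (by push_cast; ring) (by push_cast; ring) hd hhgt
      · exact finish 0 (-1) (-(1 / 2)) (-(Real.sqrt 3 / 2)) (by push_cast; ring) (by push_cast; ring)
          hd hhgt
    · push Not at hσ0
      by_cases hστ : σ + τ ≤ 0
      · -- y = (−σ−τ) d₅ + σ d₆
        have hg : (-σ - τ) ^ 2 + σ ^ 2 + (-σ - τ) * σ ≤ 1 / 3 := by
          have : y0 ^ 2 + y1 ^ 2 = (-σ - τ) ^ 2 + σ ^ 2 + (-σ - τ) * σ := by rw [hnorm]; ring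
          linarith
        obtain ⟨c0, c1, hc, hd, hhgt⟩ := planar_halfBall_core (y0 := y0) (y1 := y1)
          (n0 := ν 0) (n1 := ν 1) (n3 := ν 2) (Δ := Δ) u5 u6 a56 (by linarith) hσ0.le hg
          (by rw [hyσ]; ring) (by rw [hyτ]; ring) hn hν3 hν3' hΔ0 hΔ2
        rcases hc with ⟨rfl, rfl⟩ | ⟨rfl, rfl⟩ | ⟨rfl, rfl⟩
        · exact finish 0 0 0 0 (by push_cast; ring) (by push_cast; ring) hd hhgt
        · exact finish 0 (-1) (-(1 / 2)) (-(Real.sqrt 3 / 2)) (by push_cast; ring) (by push_cast; ring)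
            hd hhgt
        · exact finish 1 (-1) (1 / 2) (-(Real.sqrt 3 / 2)) (by push_cast; ring) (by push_cast; ring)
            hd hhgt
      · push Not at hστ
        -- y = (−τ) d₆ + (σ+τ) d₁
        have hg : (-τ) ^ 2 + (σ + τ) ^ 2 + (-τ) * (σ + τ) ≤ 1 / 3 := by
          have : y0 ^ 2 + y1 ^ 2 = (-τ) ^ 2 + (σ + τ) ^ 2 + (-τ) * (σ + τ) := by rw [hnorm]; ring
          linarith
        obtain ⟨c0, c1, hc, hd, hhgt⟩ := planar_halfBall_core (y0 := y0) (y1 := y1)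
          (n0 := ν 0) (n1 := ν 1) (n3 := ν 2) (Δ := Δ) u6 u1 a61 (by linarith) hστ.le hg
          (by rw [hyσ]; ring) (by rw [hyτ]; ring) hn hν3 hν3' hΔ0 hΔ2
        rcases hc with ⟨rfl, rfl⟩ | ⟨rfl, rfl⟩ | ⟨rfl, rfl⟩
        · exact finish 0 0 0 0 (by push_cast; ring) (by push_cast; ring) hd hhgt
        · exact finish 1 (-1) (1 / 2) (-(Real.sqrt 3 / 2)) (by push_cast; ring) (by push_cast; ring)
            hd hhgt
        · exact finish 1 0 1 0 (by push_cast; ring) (by push_cast; ring) hd hhgt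

/-- **The lower open unit half-ball of every point contains a lattice site** — basal double cone of
normals (`ν₃² ≥ 1/3`): `∃ p ∈ Λ₀, ⟪p, ν⟫ ≤ ⟪x, ν⟫ ∧ dist x p < 1`. -/
theorem exists_fcc_below_near_of_cone {ν : EuclideanSpace ℝ (Fin 3)} (hν : ‖ν‖ = 1)
    (hν3 : 1 / 3 ≤ ν 2 ^ 2) (x : EuclideanSpace ℝ (Fin 3)) :
    ∃ p ∈ fccStacking 1 (Real.sqrt (2 / 3)), ⟪p, ν⟫_ℝ ≤ ⟪x, ν⟫_ℝ ∧ dist x p < 1 := by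
  rcases le_or_gt 0 (ν 2) with h0 | h0
  · exact exists_fcc_below_near_of_cone_pos hν hν3 h0 x
  · -- lower nappe: apply the upper nappe to `−ν`, `−x` and use the point symmetry of `Λ₀`
    have hν' : ‖-ν‖ = 1 := by rw [norm_neg, hν]
    have hν3n : 1 / 3 ≤ (-ν) 2 ^ 2 := by
      have : (-ν) 2 = -(ν 2) := rfl
      rw [this, neg_sq]; exact hν3
    have h0' : 0 ≤ (-ν) 2 := by
      have : (-ν) 2 = -(ν 2) := rfl
      rw [this]; linarith
    obtain ⟨p, hp, hle, hd⟩ := exists_fcc_below_near_of_cone_pos hν' hν3n h0' (-x)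
    refine ⟨-p, fcc_neg_mem hp, ?_, ?_⟩
    · rw [inner_neg_left]
      rw [inner_neg_right, inner_neg_left, inner_neg_right, neg_neg] at hle
      linarith
    · have e1 : dist x (-p) = ‖x + p‖ := by rw [dist_eq_norm, sub_neg_eq_add]
      have e2 : dist (-x) p = ‖x + p‖ := by
        rw [dist_eq_norm, show -x - p = -(x + p) by abel, norm_neg]
      rw [e1, ← e2]; exact hd

/-! ## Films lie strictly above the cut -/

/-- **Every ball of a film on `H(ν,s)` lies strictly above the cut**, for normals in the basal double
cone `ν₃² ≥ 1/3`. -/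
theorem IsFilmOn.lt_inner_of_cone {ν : EuclideanSpace ℝ (Fin 3)} (hν : ‖ν‖ = 1)
    (hν3 : 1 / 3 ≤ ν 2 ^ 2) {s : ℝ} {Q : Finset (EuclideanSpace ℝ (Fin 3))} (hQ : IsFilmOn ν s Q)
    {q : EuclideanSpace ℝ (Fin 3)} (hq : q ∈ Q) : s < ⟪q, ν⟫_ℝ := by
  by_contra h
  push Not at h
  obtain ⟨p, hpΛ, hle, hd⟩ := exists_fcc_below_near_of_cone hν hν3 q
  have h1 := hQ.2 q hq p ⟨hpΛ, hle.trans h⟩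
  linarith

/-- **Plugs are strictly below their film ball** (basal double cone of normals). -/
theorem plug_below_of_cone {ν : EuclideanSpace ℝ (Fin 3)} (hν : ‖ν‖ = 1)
    (hν3 : 1 / 3 ≤ ν 2 ^ 2) {s : ℝ} {Q : Finset (EuclideanSpace ℝ (Fin 3))} (hQ : IsFilmOn ν s Q)
    {q : EuclideanSpace ℝ (Fin 3)} (hq : q ∈ Q) {p : EuclideanSpace ℝ (Fin 3)}
    (hp : p ∈ plugSet ν s q) : ⟪p, ν⟫_ℝ < ⟪q, ν⟫_ℝ :=
  lt_of_le_of_lt hp.1.2 (IsFilmOn.lt_inner_of_cone hν hν3 hQ hq)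

end Summit.Ventures.Crystal3D.Theorems

end
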